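import Mathlib
import HarnessLib
import Summits.HubbardSuperconductivity.HubbardSuperconductivity.Theorems.KLProgrammeC4aPPKernelTrueFlatness
import Summits.HubbardSuperconductivity.HubbardSuperconductivity.Theorems.KLProgrammeC4aPreCausticLevelLineDiagonal

/-!
# Route `KLProgramme` — crux C4a, S3 brick (B4) «(U1)-LAWS» part 5h: the THERMAL MIXED-SIGN PAIR KERNEL obeys the DIAGONAL MAJORANT of parts 5e/5f —
# `|∂_u [(g(u) − g(s))/(u − s)]| ≤ max(3,(β·lo)²)·e^{−βs/2}/max(u − s, lo)²` for `u ≥ s/2`, `g = tanh(β·/2)/2`, with the tail law from part 5e §1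

Cell `gate-hubbard-kl`, seat hubbard-kl-k3c3-p3 (g32; row «implicit-function / monotonicity route for μ(n)»).  Located brick for the (C)-closer lane / the (M4)
assembly of the umklapp first-order ϑ-layer (stub (C) `stub_twoLeg_curvature` of `KLRegimeEngineV17F2`, stmt-HubbardSuperconductivity-20437), memo
HOME/hubbard-kl-k3c3-p3/U1-CAUSTIC-SUP.md §12 («(U1)-NEG-PRE», the kernel side of the diagonal majorant).

WHY.  Part 5f (`…C4aFoldBoxPreLawBelow`) prices the pre-caustic first-order law for NEGATIVE loop levels from ONE kernel datum: a diagonal majorant `ρ` with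
`|∂ᵤK(−s,u)| ≤ ρ(s)/max(u − s, lo)²` (`u ≥ s/2`) and the tail law `∫_a^hi ρ ≤ Mρ·lo·(lo/a)²`.  In the far-far region of hubbard-kl-k3c3-p1's (M1) model (both levels
above the shell, `…C4aPPKernelTrueNumeratorFar.ppTrueNumeratorDu_of_far_of_far`: `∂ᵤN = (β/4)sech²(βu/2)` exactly) the mixed-sign pair kernel IS the thermal
difference quotient `K(−s,u) = (g(u) − g(s))/(u − s)`, `g(x) = tanh(βx/2)/2` (≡ 0 at `T = 0`).  This file proves, by two mean-value estimates and no special-function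
input beyond `tanh′ = sech²`, `sech′ = −sech·tanh`, `sech(y/2)² ≤ 4e^{−y}`, that its `u`-derivative `N(s,u)/(u − s)²`, `N = g′(u)(u − s) − (g(u) − g(s))`, satisfies
NEAR the diagonal `|N| ≤ β²e^{−β·min(s,u)}(u − s)²` and FAR from it `|N| ≤ 3e^{−βs}` (`0 ≤ s ≤ u`), hence the diagonal majorant with
`ρ(s) = max(3,(β·lo)²)·e^{−(β/2)s}` — whose tail law is part 5e §1 with `Mρ = 4·max(3,(β·lo)²)/((β/2)·lo)³`, a function of `β·lo` only (the `2/(βΛ)` currency of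
`…C4aPPKernelTrueFlatnessShape`).  What remains for the (M1) lane is identification (`ppTrueKernel β Λ (−s) u =` this quotient for `s, u` above the shell, by the
parity `N(−e,−u) = −N(e,u)` of `…C4aPPKernelTrueSigned`) and the shell region `s ≤ 2·lo`, where the plain envelope is already of majorant form.  All objects are written
out (no definitions): `g(x) = tanh(βx/2)/2`, `g′(x) = (β/4)sech²(βx/2)`, `g″(x) = −(β²/4)sech²(βx/2)tanh(βx/2)`.
* §1 `hasDerivAt_thermalHalfTanh` (`g′`), `hasDerivAt_thermalHalfTanhD` (`g″`) and sizes: `0 ≤ g′ ≤ βe^{−βx}`, `|g″| ≤ β²e^{−βx}`, `0 ≤ 1/2 − g ≤ e^{−βx}` (`x ≥ 0`).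
* §2 **`hasDerivAt_thermalDQ`** (`u ≠ s`: `∂ᵤK(−s,u) = N/(u−s)²`), **`abs_thermalDQNum_le_near`**, **`abs_thermalDQNum_le_far`**.
* §3 **`abs_thermalDQ_deriv_le_majorant`** (HEADLINE) and **`intervalIntegral_thermalMajorant_tail_le`** (the tail law, from part 5e §1).
Pure real analysis; nothing about the model beyond the shape of the thermal factor; nothing asserts (C), K3 or superconductivity.
References: BGM 2006 §2.1 (2.3), §2.4 [cite: BenfattoGiulianiMastropietro2006]; Salmhofer 1999 §4.2.5 [cite: Salmhofer1999].
-/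

noncomputable section

namespace Summit.HubbardSuperconductivity.HubbardSuperconductivity.Theorems.C4a

set_option linter.dupNamespace false -- summit = problem name (single-conjunct summit), D-0017

open Real Set MeasureTheory intervalIntegral
open Literature.Analysis.SpecialFunctions

/-! ## §1 The thermal factor `g = tanh(β·/2)/2` and its first two derivatives -/

/-- `g′(x) = (β/4)·sech²(βx/2)` for `g(x) = tanh(βx/2)/2`. [folklore] -/
theorem hasDerivAt_thermalHalfTanh (β x : ℝ) : HasDerivAt (fun x : ℝ => Real.tanh (β * x / 2) / 2) (β / 4 * sech (β * x / 2) ^ 2) x := by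
  have hin : HasDerivAt (fun x : ℝ => β * x / 2) (β / 2) x := by
    have h := ((hasDerivAt_id x).const_mul β).div_const 2
    refine h.congr_deriv ?_
    simp
  have h := ((hasDerivAt_tanh (β * x / 2)).comp x hin).div_const 2
  refine h.congr_deriv ?_
  ring

/-- `g″(x) = −(β²/4)·sech²(βx/2)·tanh(βx/2)`. [folklore] -/
theorem hasDerivAt_thermalHalfTanhD (β x : ℝ) :
    HasDerivAt (fun x : ℝ => β / 4 * sech (β * x / 2) ^ 2) (-(β ^ 2 / 4) * (sech (β * x / 2) ^ 2 * Real.tanh (β * x / 2))) x := by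
  have hin : HasDerivAt (fun x : ℝ => β * x / 2) (β / 2) x := by
    have h := ((hasDerivAt_id x).const_mul β).div_const 2
    refine h.congr_deriv ?_
    simp
  have hs : HasDerivAt (fun x : ℝ => sech (β * x / 2)) (-(sech (β * x / 2) * Real.tanh (β * x / 2)) * (β / 2)) x := by
    have h := (hasDerivAt_sech (β * x / 2)).comp x hin
    exact h
  have h := (hs.mul hs).const_mul (β / 4)
  have h2 : HasDerivAt (fun y : ℝ => β / 4 * (sech (β * y / 2) * sech (β * y / 2)))
      (β / 4 * (-(sech (β * x / 2) * Real.tanh (β * x / 2)) * (β / 2) * sech (β * x / 2) +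
        sech (β * x / 2) * (-(sech (β * x / 2) * Real.tanh (β * x / 2)) * (β / 2)))) x := h
  have heq : (fun y : ℝ => β / 4 * (sech (β * y / 2) * sech (β * y / 2))) = fun y : ℝ => β / 4 * sech (β * y / 2) ^ 2 := by
    funext y; ring
  rw [heq] at h2
  refine h2.congr_deriv ?_
  ring

/-- `|tanh y| < 1`. [folklore] -/
theorem abs_tanh_lt_one (y : ℝ) : |Real.tanh y| < 1 := by
  have h := tanh_sq_eq y
  have hs : 0 < sech y ^ 2 := pow_pos (sech_pos y) 2
  have h1 : Real.tanh y ^ 2 < 1 := by rw [h]; linarith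
  rwa [sq_lt_one_iff_abs_lt_one] at h1

/-- `0 ≤ g′(x) ≤ β·e^{−βx}` for `β > 0`, `x ≥ 0`. [folklore] -/
theorem thermalHalfTanhD_bounds {β x : ℝ} (hβ : 0 < β) (hx : 0 ≤ x) :
    0 ≤ β / 4 * sech (β * x / 2) ^ 2 ∧ β / 4 * sech (β * x / 2) ^ 2 ≤ β * Real.exp (-(β * x)) := by
  have hs := sech_half_sq_le_four_exp_neg (y := β * x) (by positivity)
  refine ⟨by positivity, ?_⟩
  calc β / 4 * sech (β * x / 2) ^ 2 ≤ β / 4 * (4 * Real.exp (-(β * x))) := mul_le_mul_of_nonneg_left hs (by positivity)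
    _ = β * Real.exp (-(β * x)) := by ring

/-- `|g″(x)| ≤ β²·e^{−βx}` for `x ≥ 0`. [folklore] -/
theorem abs_thermalHalfTanhD2_le {β x : ℝ} (hβ : 0 < β) (hx : 0 ≤ x) :
    |-(β ^ 2 / 4) * (sech (β * x / 2) ^ 2 * Real.tanh (β * x / 2))| ≤ β ^ 2 * Real.exp (-(β * x)) := by
  have hs := sech_half_sq_le_four_exp_neg (y := β * x) (by positivity)
  have ht : |Real.tanh (β * x / 2)| ≤ 1 := (abs_tanh_lt_one _).le
  have hs0 : 0 ≤ sech (β * x / 2) ^ 2 := pow_nonneg (sech_pos _).le 2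
  rw [abs_mul, abs_neg, abs_of_nonneg (by positivity : (0 : ℝ) ≤ β ^ 2 / 4), abs_mul, abs_of_nonneg hs0]
  calc β ^ 2 / 4 * (sech (β * x / 2) ^ 2 * |Real.tanh (β * x / 2)|) ≤ β ^ 2 / 4 * (4 * Real.exp (-(β * x)) * 1) := by
        gcongr
    _ = β ^ 2 * Real.exp (-(β * x)) := by ring

/-- `1 − tanh y = e^{−y}/cosh y`: `0 ≤ 1 − tanh y ≤ 2e^{−2y}`. [folklore] -/
theorem one_sub_tanh_bounds (y : ℝ) : 0 ≤ 1 - Real.tanh y ∧ 1 - Real.tanh y ≤ 2 * Real.exp (-(2 * y)) := by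
  have hc : 0 < Real.cosh y := Real.cosh_pos y
  have h1 : 1 - Real.tanh y = Real.exp (-y) / Real.cosh y := by
    rw [Real.tanh_eq_sinh_div_cosh, Real.sinh_eq, Real.cosh_eq]
    have : (Real.exp y + Real.exp (-y)) / 2 ≠ 0 := by positivity
    field_simp
    ring
  refine ⟨by have := (Real.tanh_lt_one y).le; linarith, ?_⟩
  rw [h1, div_le_iff₀ hc, Real.cosh_eq]
  have he : Real.exp (-(2 * y)) * Real.exp y = Real.exp (-y) := by rw [← Real.exp_add]; ring_nf
  have h0 : 0 ≤ Real.exp (-(2 * y)) * Real.exp (-y) := by positivity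
  nlinarith

/-- `0 ≤ 1/2 − g(x) ≤ e^{−βx}`. [folklore] -/
theorem half_sub_thermalHalfTanh_bounds (β x : ℝ) :
    0 ≤ 1 / 2 - Real.tanh (β * x / 2) / 2 ∧ 1 / 2 - Real.tanh (β * x / 2) / 2 ≤ Real.exp (-(β * x)) := by
  have h := one_sub_tanh_bounds (β * x / 2)
  have he : Real.exp (-(2 * (β * x / 2))) = Real.exp (-(β * x)) := by ring_nf
  rw [he] at h
  constructor <;> linarith [h.1, h.2]

/-! ## §2 The difference quotient `K(−s,u) = (g(u) − g(s))/(u − s)` and the numerator `N(s,u) = g′(u)(u − s) − (g(u) − g(s))` of its derivative -/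

/-- **`∂_u K(−s,u) = N(s,u)/(u − s)²`** for `u ≠ s` (quotient rule). [folklore] -/
theorem hasDerivAt_thermalDQ (β s : ℝ) {u : ℝ} (hus : u ≠ s) :
    HasDerivAt (fun u : ℝ => (Real.tanh (β * u / 2) / 2 - Real.tanh (β * s / 2) / 2) / (u - s))
      ((β / 4 * sech (β * u / 2) ^ 2 * (u - s) - (Real.tanh (β * u / 2) / 2 - Real.tanh (β * s / 2) / 2)) / (u - s) ^ 2) u := by
  have hnum : HasDerivAt (fun u : ℝ => Real.tanh (β * u / 2) / 2 - Real.tanh (β * s / 2) / 2) (β / 4 * sech (β * u / 2) ^ 2) u :=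
    (hasDerivAt_thermalHalfTanh β u).sub_const _
  have hden : HasDerivAt (fun u : ℝ => u - s) 1 u := (hasDerivAt_id u).sub_const s
  have h := hnum.div hden (sub_ne_zero.2 hus)
  refine h.congr_deriv ?_
  ring

/-- **NEAR THE DIAGONAL**: `|N(s,u)| ≤ β²·e^{−β·min(s,u)}·(u − s)²` for `s, u ≥ 0` — the mean value theorem on `t ↦ g′(t)(t − s) − (g(t) − g(s))`, whose derivative is
`g″(t)(t − s)`. [folklore] -/
theorem abs_thermalDQNum_le_near {β s u : ℝ} (hβ : 0 < β) (hs : 0 ≤ s) (hu : 0 ≤ u) :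
    |β / 4 * sech (β * u / 2) ^ 2 * (u - s) - (Real.tanh (β * u / 2) / 2 - Real.tanh (β * s / 2) / 2)| ≤
      β ^ 2 * Real.exp (-(β * min s u)) * (u - s) ^ 2 := by
  set φ : ℝ → ℝ := fun t => β / 4 * sech (β * t / 2) ^ 2 * (t - s) - (Real.tanh (β * t / 2) / 2 - Real.tanh (β * s / 2) / 2) with hφ
  have hφs : φ s = 0 := by simp [hφ]
  have hφu : φ u = β / 4 * sech (β * u / 2) ^ 2 * (u - s) - (Real.tanh (β * u / 2) / 2 - Real.tanh (β * s / 2) / 2) := rfl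
  have hder : ∀ t ∈ uIcc s u, HasDerivAt φ (-(β ^ 2 / 4) * (sech (β * t / 2) ^ 2 * Real.tanh (β * t / 2)) * (t - s)) t := fun t _ => by
    have h1 := ((hasDerivAt_thermalHalfTanhD β t).mul ((hasDerivAt_id t).sub_const s))
    have h2 := (hasDerivAt_thermalHalfTanh β t).sub_const (Real.tanh (β * s / 2) / 2)
    have h := h1.sub h2
    refine h.congr_deriv ?_
    simp only [id]
    ring
  have hmin0 : 0 ≤ min s u := le_min hs hu
  have hbound : ∀ t ∈ uIcc s u, ‖-(β ^ 2 / 4) * (sech (β * t / 2) ^ 2 * Real.tanh (β * t / 2)) * (t - s)‖ ≤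
      β ^ 2 * Real.exp (-(β * min s u)) * |u - s| := fun t ht => by
    have ht' : min s u ≤ t ∧ t ≤ max s u := by
      rcases le_total s u with h | h
      · rw [uIcc_of_le h] at ht; rw [min_eq_left h, max_eq_right h]; exact ht
      · rw [uIcc_of_ge h] at ht; rw [min_eq_right h, max_eq_left h]; exact ht
    have ht0 : 0 ≤ t := hmin0.trans ht'.1
    rw [Real.norm_eq_abs, abs_mul]
    have h1 := abs_thermalHalfTanhD2_le hβ ht0
    have h2 : Real.exp (-(β * t)) ≤ Real.exp (-(β * min s u)) := Real.exp_le_exp.2 (by nlinarith [ht'.1])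
    have h3 : |t - s| ≤ |u - s| := by
      rcases le_total s u with h | h
      · rw [uIcc_of_le h] at ht
        rw [abs_of_nonneg (by linarith [ht.1]), abs_of_nonneg (by linarith)]; linarith [ht.2]
      · rw [uIcc_of_ge h] at ht
        rw [abs_of_nonpos (by linarith [ht.2]), abs_of_nonpos (by linarith)]; linarith [ht.1]
    calc |-(β ^ 2 / 4) * (sech (β * t / 2) ^ 2 * Real.tanh (β * t / 2))| * |t - s| ≤ β ^ 2 * Real.exp (-(β * t)) * |u - s| :=
          mul_le_mul h1 h3 (abs_nonneg _) (by positivity)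
      _ ≤ β ^ 2 * Real.exp (-(β * min s u)) * |u - s| := by gcongr
  have hmvt := Convex.norm_image_sub_le_of_norm_hasDerivWithin_le (fun t ht => (hder t ht).hasDerivWithinAt) hbound (convex_uIcc s u)
    left_mem_uIcc right_mem_uIcc
  rw [hφs, sub_zero, hφu, Real.norm_eq_abs, Real.norm_eq_abs] at hmvt
  calc |β / 4 * sech (β * u / 2) ^ 2 * (u - s) - (Real.tanh (β * u / 2) / 2 - Real.tanh (β * s / 2) / 2)|
      ≤ β ^ 2 * Real.exp (-(β * min s u)) * |u - s| * |u - s| := hmvt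
    _ = β ^ 2 * Real.exp (-(β * min s u)) * (u - s) ^ 2 := by rw [← sq_abs (u - s)]; ring

/-- **FAR FROM THE DIAGONAL**: `|N(s,u)| ≤ 3·e^{−βs}` for `0 ≤ s ≤ u` — `g′(u)(u − s) ≤ e^{−βs}·(β(u−s)e^{−β(u−s)}) ≤ e^{−βs}` and
`|g(u) − g(s)| ≤ (1/2 − g(s)) + (1/2 − g(u)) ≤ 2e^{−βs}`. [folklore] -/
theorem abs_thermalDQNum_le_far {β s u : ℝ} (hβ : 0 < β) (hs : 0 ≤ s) (hsu : s ≤ u) :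
    |β / 4 * sech (β * u / 2) ^ 2 * (u - s) - (Real.tanh (β * u / 2) / 2 - Real.tanh (β * s / 2) / 2)| ≤ 3 * Real.exp (-(β * s)) := by
  have hu : 0 ≤ u := hs.trans hsu
  have hD := thermalHalfTanhD_bounds hβ hu
  have hgs := half_sub_thermalHalfTanh_bounds β s
  have hgu := half_sub_thermalHalfTanh_bounds β u
  have hus : Real.exp (-(β * u)) ≤ Real.exp (-(β * s)) := Real.exp_le_exp.2 (by nlinarith)
  -- `β(u−s)e^{−βu} ≤ e^{−βs}` from `x ≤ e^x`
  have h1 : β / 4 * sech (β * u / 2) ^ 2 * (u - s) ≤ Real.exp (-(β * s)) := by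
    have hx : β * (u - s) ≤ Real.exp (β * (u - s)) := by
      have := Real.add_one_le_exp (β * (u - s)); linarith
    have he : Real.exp (β * (u - s)) * Real.exp (-(β * u)) = Real.exp (-(β * s)) := by rw [← Real.exp_add]; ring_nf
    calc β / 4 * sech (β * u / 2) ^ 2 * (u - s) ≤ β * Real.exp (-(β * u)) * (u - s) := mul_le_mul_of_nonneg_right hD.2 (by linarith)
      _ = β * (u - s) * Real.exp (-(β * u)) := by ring
      _ ≤ Real.exp (β * (u - s)) * Real.exp (-(β * u)) := mul_le_mul_of_nonneg_right hx (Real.exp_pos _).le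
      _ = Real.exp (-(β * s)) := he
  have h1' : 0 ≤ β / 4 * sech (β * u / 2) ^ 2 * (u - s) := mul_nonneg hD.1 (by linarith)
  have h2 : |Real.tanh (β * u / 2) / 2 - Real.tanh (β * s / 2) / 2| ≤ 2 * Real.exp (-(β * s)) := by
    rw [show Real.tanh (β * u / 2) / 2 - Real.tanh (β * s / 2) / 2 =
      (1 / 2 - Real.tanh (β * s / 2) / 2) - (1 / 2 - Real.tanh (β * u / 2) / 2) by ring]
    refine (abs_sub _ _).trans ?_
    rw [abs_of_nonneg hgs.1, abs_of_nonneg hgu.1]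
    linarith [hgs.2, hgu.2]
  calc |β / 4 * sech (β * u / 2) ^ 2 * (u - s) - (Real.tanh (β * u / 2) / 2 - Real.tanh (β * s / 2) / 2)|
      ≤ |β / 4 * sech (β * u / 2) ^ 2 * (u - s)| + |Real.tanh (β * u / 2) / 2 - Real.tanh (β * s / 2) / 2| := abs_sub _ _
    _ ≤ Real.exp (-(β * s)) + 2 * Real.exp (-(β * s)) := add_le_add (by rw [abs_of_nonneg h1']; exact h1) h2
    _ = 3 * Real.exp (-(β * s)) := by ring

/-! ## §3 The diagonal majorant of the thermal mixed-sign kernel -/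

/-- **THE THERMAL MIXED-SIGN KERNEL OBEYS THE DIAGONAL MAJORANT** (HEADLINE).  `0 < β`, `0 < lo`, `0 < s`, `s/2 ≤ u`, `u ≠ s`:
`|N(s,u)/(u − s)²| ≤ max(3,(β·lo)²)·e^{−(β/2)s}·(max(u − s, lo))⁻²` — the `hK1` row of `…C4aFoldBoxPreLawBelow.intervalIntegral_partnerBand_pre_below_le` for the
derivative `N/(u−s)²` of `u ↦ K(−s,u)` (`hasDerivAt_thermalDQ`), with `ρ(s) = max(3,(β·lo)²)·e^{−(β/2)s}`. [folklore] -/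
theorem abs_thermalDQ_deriv_le_majorant {β lo s u : ℝ} (hβ : 0 < β) (hlo : 0 < lo) (hs : 0 < s) (hsu : s / 2 ≤ u) (hus : u ≠ s) :
    |(β / 4 * sech (β * u / 2) ^ 2 * (u - s) - (Real.tanh (β * u / 2) / 2 - Real.tanh (β * s / 2) / 2)) / (u - s) ^ 2| ≤
      max 3 ((β * lo) ^ 2) * Real.exp (-(β / 2 * s)) * ((max (u - s) lo)⁻¹ ^ 2) := by
  have hu0 : 0 ≤ u := by linarith
  have hsq : 0 < (u - s) ^ 2 := by
    have : u - s ≠ 0 := sub_ne_zero.2 hus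
    positivity
  rw [abs_div, abs_of_pos hsq]
  set N := β / 4 * sech (β * u / 2) ^ 2 * (u - s) - (Real.tanh (β * u / 2) / 2 - Real.tanh (β * s / 2) / 2) with hN
  set M := max (u - s) lo with hM
  have hMlo : lo ≤ M := le_max_right _ _
  have hMpos : 0 < M := hlo.trans_le hMlo
  have hR3 : (3 : ℝ) ≤ max 3 ((β * lo) ^ 2) := le_max_left _ _
  have hRb : (β * lo) ^ 2 ≤ max 3 ((β * lo) ^ 2) := le_max_right _ _
  have hR0 : 0 ≤ max 3 ((β * lo) ^ 2) := le_trans (by norm_num) hR3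
  -- `e^{−βs} ≤ e^{−βs/2}` and `e^{−β·min(s,u)} ≤ e^{−βs/2}`
  have hes : Real.exp (-(β * s)) ≤ Real.exp (-(β / 2 * s)) := Real.exp_le_exp.2 (by nlinarith)
  have hemin : Real.exp (-(β * min s u)) ≤ Real.exp (-(β / 2 * s)) := by
    refine Real.exp_le_exp.2 ?_
    have : s / 2 ≤ min s u := le_min (by linarith) hsu
    nlinarith
  have hnear := abs_thermalDQNum_le_near hβ hs.le hu0
  rw [← hN] at hnear
  have hnear' : |N| / (u - s) ^ 2 ≤ β ^ 2 * Real.exp (-(β / 2 * s)) := by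
    rw [div_le_iff₀ hsq]
    refine hnear.trans ?_
    have : 0 ≤ β ^ 2 * (u - s) ^ 2 := by positivity
    nlinarith [mul_le_mul_of_nonneg_left hemin this]
  rw [inv_pow]
  rcases lt_or_ge (u - s) lo with hlt | hge
  · -- `M = lo`: the near form, `β² = (βlo)²/lo²`
    have hMeq : M = lo := by rw [hM, max_eq_right hlt.le]
    rw [hMeq]
    calc |N| / (u - s) ^ 2 ≤ β ^ 2 * Real.exp (-(β / 2 * s)) := hnear'
      _ = (β * lo) ^ 2 * Real.exp (-(β / 2 * s)) * (lo ^ 2)⁻¹ := by field_simp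
      _ ≤ max 3 ((β * lo) ^ 2) * Real.exp (-(β / 2 * s)) * (lo ^ 2)⁻¹ := by gcongr
  · -- `M = u − s ≥ lo > 0`: `u > s`, the far form
    have hMeq : M = u - s := by rw [hM, max_eq_left hge]
    have hsu' : s ≤ u := by linarith
    have hfar := abs_thermalDQNum_le_far hβ hs.le hsu'
    rw [← hN] at hfar
    rw [hMeq]
    calc |N| / (u - s) ^ 2 ≤ 3 * Real.exp (-(β * s)) / (u - s) ^ 2 := div_le_div_of_nonneg_right hfar hsq.le
      _ = 3 * Real.exp (-(β * s)) * ((u - s) ^ 2)⁻¹ := by rw [div_eq_mul_inv]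
      _ ≤ max 3 ((β * lo) ^ 2) * Real.exp (-(β / 2 * s)) * ((u - s) ^ 2)⁻¹ := by gcongr

/-- **THE TAIL LAW OF THE THERMAL MAJORANT**: `ρ(s) = max(3,(β·lo)²)·e^{−(β/2)s}` obeys `∫_a^hi ρ ≤ Mρ·lo·(lo/a)²` for `lo ≤ a`, with
`Mρ = 4·max(3,(β·lo)²)/((β/2)·lo)³` — a function of `β·lo` alone (part 5e §1). [folklore] -/
theorem intervalIntegral_thermalMajorant_tail_le {β lo a : ℝ} (hβ : 0 < β) (hlo : 0 < lo) (ha : lo ≤ a) (hi : ℝ) :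
    ∫ s in a..hi, max 3 ((β * lo) ^ 2) * Real.exp (-(β / 2 * s)) ≤ 4 * max 3 ((β * lo) ^ 2) / (β / 2 * lo) ^ 3 * (lo * (lo / a) ^ 2) :=
  intervalIntegral_exp_tail_le (le_trans (by norm_num) (le_max_left _ _)) (by positivity) hlo ha hi

end Summit.HubbardSuperconductivity.HubbardSuperconductivity.Theorems.C4a

end
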